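import Summits.QuantumFields.BalabanUV.T4Continuum.Support.VariationalVectorInterpolant
import Summits.QuantumFields.BalabanUV.T4Continuum.Support.VectorLineComposite
import Summits.QuantumFields.BalabanUV.T4Continuum.Support.VariationalColourTower
import Literature.MathematicalPhysics.QuantumFieldTheory.Balaban1983to89.Beta.FluctuationProjection
import Summits.QuantumFields.BalabanUV.T4Continuum.Support.VariationalColourTaxiLines

/-!
# T⁴ programme, spine node NE2 (U1a), lane P2 — V-COMP-FRAME: THE TOWER's COMPOSITE LINE CARRIERS STAY NEAR THE FRAME CARRIERS
# (`t4/skeletons/NE2-t4-ne2-p2.md` v0.15 §2.E, rows V-COMP ∕ V-UB ∕ V-P; model level; cell `pub-balaban`)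

NE2 formalisation swarm `b2b-balaban-t4-ne2-formalise-*`, leaf prover 10 GEN 3 (`prover-b2b-balaban-t4-ne2-formalise-leaf-10-g3-0`, lineage V-COMP TOWER);
journal INTENT CLAIMS.log 2026-08-20 14:59Z.  On top of leaf-01-g6's `VariationalVectorInterpolant.frameT` (p219088), leaf-03-g4's `VectorLineComposite.compL`
(p218283), leaf-02-g4's composite site operators `VariationalColourTower.compTv` (p215185) and leaf-04-g4's digit bookkeeping
`VariationalColourTaxiTransport.bpt_eq_update_zero_add` (`VariationalColourTaxiLines`) — BY NAME; nothing defined.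

THE POINT.  The vector END (`VariationalVectorEndOfLeaves`, p220074) forces the level-`k+1` line carriers to be the COMPOSITES `compL (T k) (T′ k)`; the per-level
suppliers of V-UB (`VectorLineTransportFrame.exists_ubV_nearFrame_ScV`, p220640), V-ONE (file 9, p221498) and V-P (`VariationalVectorPoincareNear`, p219305) accept
GENERAL line carriers within `γ` of a reference carrier.  With the one-step carriers CHOSEN frame-adapted, `T′ k := frameT (U′ k) (R k)`, this file shows the
composites stay frame carriers up to the frame-adaptedness defects:
 * §1 line-point bookkeeping: own points `bpt x j + t e_μ = bpt x (j + t e_μ)` (`j_μ + t < L`), SPILL points `= bpt (x + e_μ) (…)` (`L ≤ j_μ + t`), their blocks,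
   and the four-case arithmetic of the long-line own∕spill condition `(j₁μ + t₁) + L(j₂μ + t₂) < nL`;
 * §2 **`norm_compL_frameT_sub_le`**: for frames `U` (level `n`), `U′` (level `n·L`), unit-lattice bond operators `Rc` and level-`n` bond operators `R` with
   `‖Rc‖, ‖U′‖ ≤ 1` and the two ADAPTEDNESS defects of `U` w.r.t. `R` ∕ `Rc` — in-block `‖U(x)R(x,μ) − U(x+e_μ)‖ ≤ m` (`x`, `x+e_μ` in one block) and cross-face
   `‖U(x)R(x,μ) − Rc(y,μ)U(x+e_μ)‖ ≤ m` (`x` at the far `μ`-face of block `y`) — at every long line and position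
   `‖compL n L M (frameT n M U Rc) (frameT L (fine n M) U′ R) y J U μ − frameT (n·L) M (compTv n L M U U′) Rc y J U μ‖ ≤ m`
   (own∕own and spill∕own are EXACT equalities; own∕spill and spill∕spill are off by one adaptedness defect);
 * §3 `norm_compL_sub_compL_le` (`compL` is 1-Lipschitz in the outer carrier for contractive inner ones) and **`tower_near_frameT`**: along `n_k = L^k` with
   `T (k+1) = compL (L^k) L M (T k) (frameT L _ (U′ k) (R k))`, composite frames `U (k+1) = compTv (L^k) L M (U k) (U′ k)` and `T 0 = frameT 1 M (U 0) Rc`: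
   `‖T k y j t μ − frameT (L^k) M (U k) Rc y j t μ‖ ≤ Σ_{i<k} m i` — the `γ_k` of the suppliers, k-UNIFORM under a summable class (`n_i²·m_i ≤ c` ⟹ `≤ c·L²∕(L²−1)`,
   `tower_near_frameT_of_class`).
HONEST: the adaptedness defects are DATA here (for frames built by parallel transport along taxi paths they are plaquette-sized — leaf-04's dictionary); nothing
of V-GF ∕ V-REG; no leaf discharged.

HONEST FRAMING (T4-DAG p. 1).  Model level; frames ∕ transports DATA (no identification with Bałaban's `U(Γ)` — c5); [folklore] index bookkeeping + triangle
inequalities; nothing printed is a hypothesis; no `def`, no `def … : Prop`, no `sorry`; axioms standard.  V-END ∕ NE2 NOT proved; spine PROVED 0∕9 unchanged; rung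
(B)+1 finite T⁴ — NOT infinite volume, NOT mass gap, NOT Clay.  HONEST DEPENDENCY (cell, verbatim): continuum YM on T⁴ ⇐ BetaPertH ∧ nine spine estimates (0/9
proved); BetaPertH ⇐ (D1) ∧ (D4) ∧ CAP+tail; G-an2-4 gates asym, D1 and NE2/3/4.
-/

noncomputable section

namespace Summit.QuantumFields.BalabanUV.T4Continuum.VariationalVectorFrameTower

open Finset
open Literature.MathematicalPhysics.QuantumFieldTheory.Balaban1983to89.B5Prop11Plancherel (Tor fine unitVec)
open Literature.MathematicalPhysics.QuantumFieldTheory.Balaban1983to89.B5Block118 (tstep tstep_zero tstep_succ bpt bpt_add_tstep)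
open Literature.MathematicalPhysics.QuantumFieldTheory.Balaban1983to89.B5Blocks16 (blockOf blockOf_bpt)
open Literature.MathematicalPhysics.QuantumFieldTheory.Balaban1983to89.B5Composition116 (sites J JEquiv JEquiv_apply J_val bpt_bpt_tstep tstep_add)
open Literature.MathematicalPhysics.QuantumFieldTheory.Balaban1983to89.Beta.FluctuationProjection (bpt_add_tstep_of_lt)
open Summit.QuantumFields.BalabanUV.T4Continuum.ScalarBlockTrialFunction (bpt_update')
open Summit.QuantumFields.BalabanUV.T4Continuum.VectorBlockTrialForm (compL compL_J val_finProdFinEquiv)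
open Summit.QuantumFields.BalabanUV.T4Continuum.VariationalVectorInterpolant (frameT)
open Summit.QuantumFields.BalabanUV.T4Continuum.VariationalColourTower (compTv)
open Summit.QuantumFields.BalabanUV.T4Continuum.VariationalColourTaxiTransport (bpt_eq_update_zero_add)

variable {d : ℕ} {E : Type*} [NormedAddCommGroup E] [InnerProductSpace ℂ E]

/-! ## §1 Line points: own and spill, their blocks -/

section Points

variable (L : ℕ) [NeZero L] (N : Fin d → ℕ) [hN : ∀ μ, NeZero (N μ)]

omit hN in
/-- a SPILL point of the line from `bpt x j` (position `t` with `j_μ + t = L + s`, `s < L`) is an own point of the NEXT block `x + e_μ`. [folklore] -/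
theorem line_point_spill (x : Tor N) (j : Fin d → Fin L) (μ : Fin d) (t s : ℕ) (hts : (j μ : ℕ) + t = L + s) (hs : s < L) :
    bpt L N x j + tstep (fine L N) μ t
      = bpt L N (x + unitVec N μ) (Function.update (Function.update j μ 0) μ ⟨s, hs⟩) := by
  have h0 : ((Function.update j μ (0 : Fin L)) μ : ℕ) + s < L := by simp; exact hs
  rw [bpt_eq_update_zero_add L N x j μ, add_assoc, ← tstep_add, hts, tstep_add, ← add_assoc, bpt_add_tstep,
    bpt_add_tstep_of_lt L N (x + unitVec N μ) (Function.update j μ 0) μ s h0]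
  congr 2
  ext; simp

/-- the block of an own point. [folklore] -/
theorem blockOf_line_point_own (x : Tor N) (j : Fin d → Fin L) (μ : Fin d) (t : ℕ) (hlt : (j μ : ℕ) + t < L) :
    blockOf L N (bpt L N x j + tstep (fine L N) μ t) = x := by
  rw [bpt_add_tstep_of_lt L N x j μ t hlt, blockOf_bpt]

/-- the block of a spill point. [folklore] -/
theorem blockOf_line_point_spill (x : Tor N) (j : Fin d → Fin L) (μ : Fin d) (t s : ℕ) (hts : (j μ : ℕ) + t = L + s) (hs : s < L) :
    blockOf L N (bpt L N x j + tstep (fine L N) μ t) = x + unitVec N μ := by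
  rw [line_point_spill L N x j μ t s hts hs, blockOf_bpt]

end Points

/-! ### the long-line own∕spill arithmetic -/

section Arith

/-- own∕own ⟹ long own. [folklore] -/
theorem long_own_of_own_own {n L a b : ℕ} (ha : a < n) (hb : b < L) : b + L * a < n * L := by
  have h1 : L * (a + 1) ≤ L * n := Nat.mul_le_mul_left L ha
  rw [Nat.mul_succ] at h1
  rw [Nat.mul_comm n L]
  omega

/-- own (not at the far face) ∕ spill ⟹ long own. [folklore] -/
theorem long_own_of_own_spill {n L a b : ℕ} (ha : a + 1 < n) (hb : b < L + L) : b + L * a < n * L := by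
  have h1 : L * (a + 2) ≤ L * n := Nat.mul_le_mul_left L ha
  rw [Nat.mul_add] at h1
  rw [Nat.mul_comm n L]
  omega

/-- own AT the far face ∕ spill ⟹ long spill. [folklore] -/
theorem long_spill_of_face_spill {n L a b : ℕ} (ha : a + 1 = n) (hb : L ≤ b) : ¬ (b + L * a < n * L) := by
  have h1 : L * n = L * a + L := by rw [← ha, Nat.mul_succ]
  rw [Nat.mul_comm n L, h1]
  omega

/-- coarse spill ⟹ long spill. [folklore] -/
theorem long_spill_of_spill {n L a b : ℕ} (ha : n ≤ a) : ¬ (b + L * a < n * L) := by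
  have h1 : L * n ≤ L * a := Nat.mul_le_mul_left L ha
  rw [Nat.mul_comm n L]
  omega

end Arith

/-! ## §2 The composite of frame carriers against the frame carrier of the composite frames -/

section Composite

variable (n L : ℕ) [NeZero n] [NeZero L] (M : Fin d → ℕ) [hM : ∀ μ, NeZero (M μ)]
variable {U : Tor (fine n M) → (E →L[ℂ] E)} {U' : Tor (fine L (fine n M)) → (E →L[ℂ] E)}
variable {Rc : Tor M → Fin d → (E →L[ℂ] E)} {R : Tor (fine n M) → Fin d → (E →L[ℂ] E)}

/-- **THE COMPOSITE OF FRAME CARRIERS IS A FRAME CARRIER UP TO THE ADAPTEDNESS DEFECT** (split indices): see the module docstring. [folklore] -/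
theorem norm_compL_frameT_sub_le_split (hRc : ∀ y μ, ‖Rc y μ‖ ≤ 1) (hU' : ∀ x, ‖U' x‖ ≤ 1) {m : ℝ} (hm : 0 ≤ m)
    (hin : ∀ (y : Tor M) (j : Fin d → Fin n) (μ : Fin d), (j μ : ℕ) + 1 < n →
      ‖U (bpt n M y j) * R (bpt n M y j) μ - U (bpt n M y j + unitVec (fine n M) μ)‖ ≤ m)
    (hcross : ∀ (y : Tor M) (j : Fin d → Fin n) (μ : Fin d), (j μ : ℕ) + 1 = n →
      ‖U (bpt n M y j) * R (bpt n M y j) μ - Rc y μ * U (bpt n M y j + unitVec (fine n M) μ)‖ ≤ m)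
    (y : Tor M) (j₂ : Fin d → Fin n) (j₁ : Fin d → Fin L) (t₂ : Fin n) (t₁ : Fin L) (μ : Fin d) :
    ‖compL n L M (frameT n M U Rc) (frameT L (fine n M) U' R) y (J n L j₂ j₁) (finProdFinEquiv (t₂, t₁)) μ
      - frameT (n * L) M (compTv n L M U U') Rc y (J n L j₂ j₁) (finProdFinEquiv (t₂, t₁)) μ‖ ≤ m := by
  -- the long line's point, read through `sites`, is the inner line's point
  have hP : sites n L M (bpt (n * L) M y (J n L j₂ j₁) + tstep (fine (n * L) M) μ ((finProdFinEquiv (t₂, t₁) : Fin (n * L)) : ℕ))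
      = bpt L (fine n M) (bpt n M y j₂ + tstep (fine n M) μ t₂) j₁ + tstep (fine L (fine n M)) μ t₁ := by
    rw [val_finProdFinEquiv, bpt_bpt_tstep]
  have hJ : ((J n L j₂ j₁ μ : ℕ)) + ((finProdFinEquiv (t₂, t₁) : Fin (n * L)) : ℕ) = ((j₁ μ : ℕ) + t₁) + L * ((j₂ μ : ℕ) + t₂) := by
    rw [J_val, val_finProdFinEquiv]; ring
  rw [compL_J]
  simp only [frameT, compTv, hP, hJ]
  -- the digits
  have hj₁ : (j₁ μ : ℕ) < L := (j₁ μ).isLt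
  have ht₁ : (t₁ : ℕ) < L := t₁.isLt
  have hj₂ : (j₂ μ : ℕ) < n := (j₂ μ).isLt
  have ht₂ : (t₂ : ℕ) < n := t₂.isLt
  set x₂ : Tor (fine n M) := bpt n M y j₂ + tstep (fine n M) μ t₂ with hx₂
  set x₁ : Tor (fine L (fine n M)) := bpt L (fine n M) x₂ j₁ + tstep (fine L (fine n M)) μ t₁ with hx₁
  by_cases hA : (j₂ μ : ℕ) + (t₂ : ℕ) < n
  · -- coarse own: `x₂` is an in-block point of block `y` with digit `a = j₂μ + t₂`
    rw [if_pos hA]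
    by_cases hB : (j₁ μ : ℕ) + (t₁ : ℕ) < L
    · -- fine own: exact
      rw [if_pos hB, if_pos (long_own_of_own_own hA (by omega : (j₁ μ : ℕ) + t₁ < L)), hx₁, blockOf_line_point_own L (fine n M) x₂ j₁ μ t₁ hB,
        sub_self, norm_zero]
      exact hm
    · -- fine spill: `x₁` lies in the next fine block `x₂ + e_μ`
      rw [if_neg hB]
      obtain ⟨s, hs⟩ := Nat.exists_eq_add_of_le (Nat.le_of_not_lt hB)
      have hsL : s < L := by omega
      have hblk : blockOf L (fine n M) x₁ = x₂ + unitVec (fine n M) μ := by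
        rw [hx₁]; exact blockOf_line_point_spill L (fine n M) x₂ j₁ μ t₁ s hs hsL
      rw [hblk]
      have hx₂' : x₂ = bpt n M y (Function.update j₂ μ ⟨(j₂ μ : ℕ) + t₂, hA⟩) := by
        rw [hx₂]; exact bpt_add_tstep_of_lt n M y j₂ μ t₂ hA
      by_cases hA' : (j₂ μ : ℕ) + (t₂ : ℕ) + 1 < n
      · -- not at the far face: long own, in-block adaptedness
        rw [if_pos (long_own_of_own_spill hA' (by omega))]
        have key := hin y (Function.update j₂ μ ⟨(j₂ μ : ℕ) + t₂, hA⟩) μ (by simpa using hA')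
        rw [← hx₂'] at key
        calc ‖U x₂ * (R x₂ μ * U' x₁) - U (x₂ + unitVec (fine n M) μ) * U' x₁‖
            = ‖(U x₂ * R x₂ μ - U (x₂ + unitVec (fine n M) μ)) * U' x₁‖ := by rw [sub_mul, mul_assoc]
          _ ≤ ‖U x₂ * R x₂ μ - U (x₂ + unitVec (fine n M) μ)‖ * ‖U' x₁‖ := norm_mul_le _ _
          _ ≤ m * 1 := mul_le_mul key (hU' x₁) (norm_nonneg _) hm
          _ = m := mul_one m
      · -- at the far face: long spill, cross-face adaptedness
        have hface : (j₂ μ : ℕ) + (t₂ : ℕ) + 1 = n := by omega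
        rw [if_neg (long_spill_of_face_spill hface (by omega))]
        have key := hcross y (Function.update j₂ μ ⟨(j₂ μ : ℕ) + t₂, hA⟩) μ (by simpa using hface)
        rw [← hx₂'] at key
        calc ‖U x₂ * (R x₂ μ * U' x₁) - Rc y μ * (U (x₂ + unitVec (fine n M) μ) * U' x₁)‖
            = ‖(U x₂ * R x₂ μ - Rc y μ * U (x₂ + unitVec (fine n M) μ)) * U' x₁‖ := by rw [sub_mul, mul_assoc, mul_assoc]
          _ ≤ ‖U x₂ * R x₂ μ - Rc y μ * U (x₂ + unitVec (fine n M) μ)‖ * ‖U' x₁‖ := norm_mul_le _ _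
          _ ≤ m * 1 := mul_le_mul key (hU' x₁) (norm_nonneg _) hm
          _ = m := mul_one m
  · -- coarse spill: `x₂` lies in block `y + e_μ`; long spill always
    rw [if_neg hA, if_neg (long_spill_of_spill (Nat.le_of_not_lt hA))]
    by_cases hB : (j₁ μ : ℕ) + (t₁ : ℕ) < L
    · -- fine own: exact
      rw [if_pos hB, hx₁, blockOf_line_point_own L (fine n M) x₂ j₁ μ t₁ hB, mul_assoc, sub_self, norm_zero]
      exact hm
    · -- fine spill: in-block adaptedness in block `y + e_μ`
      rw [if_neg hB]
      obtain ⟨s, hs⟩ := Nat.exists_eq_add_of_le (Nat.le_of_not_lt hB)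
      have hsL : s < L := by omega
      have hblk : blockOf L (fine n M) x₁ = x₂ + unitVec (fine n M) μ := by
        rw [hx₁]; exact blockOf_line_point_spill L (fine n M) x₂ j₁ μ t₁ s hs hsL
      rw [hblk]
      obtain ⟨s₂, hs₂⟩ := Nat.exists_eq_add_of_le (Nat.le_of_not_lt hA)
      have hs₂n : s₂ + 1 < n := by omega
      have hx₂' : x₂ = bpt n M (y + unitVec M μ) (Function.update (Function.update j₂ μ 0) μ ⟨s₂, by omega⟩) := by
        rw [hx₂]; exact line_point_spill n M y j₂ μ t₂ s₂ hs₂ (by omega)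
      have key := hin (y + unitVec M μ) (Function.update (Function.update j₂ μ 0) μ ⟨s₂, by omega⟩) μ (by simpa using hs₂n)
      rw [← hx₂'] at key
      calc ‖Rc y μ * U x₂ * (R x₂ μ * U' x₁) - Rc y μ * (U (x₂ + unitVec (fine n M) μ) * U' x₁)‖
          = ‖Rc y μ * ((U x₂ * R x₂ μ - U (x₂ + unitVec (fine n M) μ)) * U' x₁)‖ := by
            congr 1; noncomm_ring
        _ ≤ ‖Rc y μ‖ * (‖U x₂ * R x₂ μ - U (x₂ + unitVec (fine n M) μ)‖ * ‖U' x₁‖) :=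
            (norm_mul_le _ _).trans (mul_le_mul_of_nonneg_left (norm_mul_le _ _) (norm_nonneg _))
        _ ≤ 1 * (m * 1) := mul_le_mul (hRc y μ) (mul_le_mul key (hU' x₁) (norm_nonneg _) hm) (by positivity) zero_le_one
        _ = m := by ring

end Composite

section Unsplit

variable (n L : ℕ) [NeZero n] [NeZero L] (M : Fin d → ℕ) [hM : ∀ μ, NeZero (M μ)]
variable {U : Tor (fine n M) → (E →L[ℂ] E)} {U' : Tor (fine L (fine n M)) → (E →L[ℂ] E)}
variable {Rc : Tor M → Fin d → (E →L[ℂ] E)} {R : Tor (fine n M) → Fin d → (E →L[ℂ] E)}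

/-- **THE COMPOSITE OF FRAME CARRIERS IS A FRAME CARRIER UP TO THE ADAPTEDNESS DEFECT**: for every long line `(y, J)`, position `U` and direction `μ`,
`‖compL (frameT U Rc) (frameT U′ R) y J U μ − frameT (compTv U U′) Rc y J U μ‖ ≤ m`. [folklore] -/
theorem norm_compL_frameT_sub_le (hRc : ∀ y μ, ‖Rc y μ‖ ≤ 1) (hU' : ∀ x, ‖U' x‖ ≤ 1) {m : ℝ} (hm : 0 ≤ m)
    (hin : ∀ (y : Tor M) (j : Fin d → Fin n) (μ : Fin d), (j μ : ℕ) + 1 < n →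
      ‖U (bpt n M y j) * R (bpt n M y j) μ - U (bpt n M y j + unitVec (fine n M) μ)‖ ≤ m)
    (hcross : ∀ (y : Tor M) (j : Fin d → Fin n) (μ : Fin d), (j μ : ℕ) + 1 = n →
      ‖U (bpt n M y j) * R (bpt n M y j) μ - Rc y μ * U (bpt n M y j + unitVec (fine n M) μ)‖ ≤ m)
    (y : Tor M) (Jx : Fin d → Fin (n * L)) (Ux : Fin (n * L)) (μ : Fin d) :
    ‖compL n L M (frameT n M U Rc) (frameT L (fine n M) U' R) y Jx Ux μ - frameT (n * L) M (compTv n L M U U') Rc y Jx Ux μ‖ ≤ m := by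
  obtain ⟨⟨j₂, j₁⟩, hJ⟩ := (JEquiv n L).surjective Jx
  obtain ⟨⟨t₂, t₁⟩, hU⟩ := finProdFinEquiv.surjective Ux
  rw [← hJ, ← hU, JEquiv_apply]
  exact norm_compL_frameT_sub_le_split n L M hRc hU' hm hin hcross y j₂ j₁ t₂ t₁ μ

omit [NeZero n] [NeZero L] hM in
/-- `compL` is 1-Lipschitz in the OUTER carrier when the inner carrier is contractive. [folklore] -/
theorem norm_compL_sub_compL_le {T S : Tor M → (Fin d → Fin n) → Fin n → Fin d → (E →L[ℂ] E)}
    {T' : Tor (fine n M) → (Fin d → Fin L) → Fin L → Fin d → (E →L[ℂ] E)} (hT' : ∀ x j t μ, ‖T' x j t μ‖ ≤ 1) {γ : ℝ}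
    (hTS : ∀ y j t μ, ‖T y j t μ - S y j t μ‖ ≤ γ) (y : Tor M) (Jx : Fin d → Fin (n * L)) (Ux : Fin (n * L)) (μ : Fin d) :
    ‖compL n L M T T' y Jx Ux μ - compL n L M S T' y Jx Ux μ‖ ≤ γ := by
  have hγ : 0 ≤ γ := (norm_nonneg _).trans (hTS y ((JEquiv n L).symm Jx).1 (finProdFinEquiv.symm Ux).1 μ)
  unfold compL
  rw [← sub_mul]
  refine (norm_mul_le _ _).trans ?_
  calc _ ≤ γ * 1 := mul_le_mul (hTS _ _ _ _) (hT' _ _ _ _) (norm_nonneg _) hγ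
    _ = γ := mul_one γ

omit [NeZero n] [NeZero L] hM in
/-- frame carriers with contractive frames and coarse bond operators are contractive. [folklore] -/
theorem norm_frameT_le_one {N : Fin d → ℕ} {U' : Tor (fine L N) → (E →L[ℂ] E)} {Rc : Tor N → Fin d → (E →L[ℂ] E)}
    (hU' : ∀ x, ‖U' x‖ ≤ 1) (hRc : ∀ y μ, ‖Rc y μ‖ ≤ 1) (y : Tor N) (j : Fin d → Fin L) (t : Fin L) (ν : Fin d) :
    ‖frameT L N U' Rc y j t ν‖ ≤ 1 := by
  unfold frameT
  split_ifs
  · exact hU' _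
  · exact (norm_mul_le _ _).trans (by nlinarith [hRc y ν, hU' (bpt L N y j + tstep (fine L N) ν t), norm_nonneg (Rc y ν)])

end Unsplit

/-! ## §3 Along the tower: the composite carriers stay within `Σ m_i` of the frame carriers -/

section Tower

variable (L : ℕ) [NeZero L] (M : Fin d → ℕ) [hM : ∀ μ, NeZero (M μ)]
variable (U : (k : ℕ) → Tor (fine (L ^ k) M) → (E →L[ℂ] E)) (U' : (k : ℕ) → Tor (fine L (fine (L ^ k) M)) → (E →L[ℂ] E))
variable (R : (k : ℕ) → Tor (fine (L ^ k) M) → Fin d → (E →L[ℂ] E)) (Rc : Tor M → Fin d → (E →L[ℂ] E))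
variable (T : (k : ℕ) → Tor M → (Fin d → Fin (L ^ k)) → Fin (L ^ k) → Fin d → (E →L[ℂ] E))

/-- **THE COMP TOWER's CARRIERS STAY NEAR THE FRAME CARRIERS**: with one-step carriers `frameT (U′ k) (R k)`, composites `T (k+1) = compL (T k) (frameT …)`,
composite frames `U (k+1) = compTv (U k) (U′ k)`, contractive `Rc`, `U′ k`, the level-`k` adaptedness defects `≤ m k`, and `T 0` within `γ₀` of its frame
carrier: `‖T k y j t μ − frameT (L^k) M (U k) Rc y j t μ‖ ≤ γ₀ + Σ_{i<k} m i`. [folklore] -/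
theorem tower_near_frameT (hRc : ∀ y μ, ‖Rc y μ‖ ≤ 1) (hU' : ∀ k x, ‖U' k x‖ ≤ 1) (hR : ∀ k x μ, ‖R k x μ‖ ≤ 1)
    (hTcomp : ∀ k, T (k + 1) = compL (L ^ k) L M (T k) (frameT L (fine (L ^ k) M) (U' k) (R k)))
    (hUcomp : ∀ k, U (k + 1) = compTv (L ^ k) L M (U k) (U' k))
    {m : ℕ → ℝ} (hm : ∀ k, 0 ≤ m k)
    (hin : ∀ k (y : Tor M) (j : Fin d → Fin (L ^ k)) (μ : Fin d), (j μ : ℕ) + 1 < L ^ k →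
      ‖U k (bpt (L ^ k) M y j) * R k (bpt (L ^ k) M y j) μ - U k (bpt (L ^ k) M y j + unitVec (fine (L ^ k) M) μ)‖ ≤ m k)
    (hcross : ∀ k (y : Tor M) (j : Fin d → Fin (L ^ k)) (μ : Fin d), (j μ : ℕ) + 1 = L ^ k →
      ‖U k (bpt (L ^ k) M y j) * R k (bpt (L ^ k) M y j) μ - Rc y μ * U k (bpt (L ^ k) M y j + unitVec (fine (L ^ k) M) μ)‖ ≤ m k)
    {γ₀ : ℝ} (h0 : ∀ y j t μ, ‖T 0 y j t μ - frameT (L ^ 0) M (U 0) Rc y j t μ‖ ≤ γ₀) :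
    ∀ (k : ℕ) (y : Tor M) (j : Fin d → Fin (L ^ k)) (t : Fin (L ^ k)) (μ : Fin d),
      ‖T k y j t μ - frameT (L ^ k) M (U k) Rc y j t μ‖ ≤ γ₀ + ∑ i ∈ Finset.range k, m i := by
  intro k
  induction k with
  | zero => intro y j t μ; simpa using h0 y j t μ
  | succ k ih =>
    intro y j t μ
    have e1 : T (k + 1) y j t μ = compL (L ^ k) L M (T k) (frameT L (fine (L ^ k) M) (U' k) (R k)) y j t μ := by rw [hTcomp k]
    have e2 : frameT (L ^ (k + 1)) M (U (k + 1)) Rc y j t μ = frameT (L ^ k * L) M (compTv (L ^ k) L M (U k) (U' k)) Rc y j t μ := by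
      rw [hUcomp k]; rfl
    rw [e1, e2, Finset.sum_range_succ, ← add_assoc]
    have hF : ∀ x j' t' ν, ‖frameT L (fine (L ^ k) M) (U' k) (R k) x j' t' ν‖ ≤ 1 :=
      norm_frameT_le_one L (hU' k) (hR k)
    have h1 := norm_compL_sub_compL_le (L ^ k) L M (T := T k) (S := frameT (L ^ k) M (U k) Rc) hF ih y j t μ
    have h2 := norm_compL_frameT_sub_le (L ^ k) L M (U := U k) (U' := U' k) (Rc := Rc) (R := R k) hRc (hU' k) (hm k) (hin k) (hcross k) y j t μ
    exact (norm_sub_le_norm_sub_add_norm_sub _ _ _).trans (add_le_add h1 h2)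


omit [NeZero L] hM in
/-- the summable class: `(L^i)²·m_i ≤ c` (`m ≥ 0`), `2 ≤ L` ⟹ `Σ_{i<k} m_i ≤ c·L²∕(L²−1)` for every `k` (geometric tail, as in `VariationalTowerDefect` §3).
[folklore] -/
theorem sum_defects_le_of_class (hL : 2 ≤ L) {m : ℕ → ℝ} {c : ℝ} (hm : ∀ k, 0 ≤ m k) (hmc : ∀ k, (((L ^ k : ℕ)) : ℝ) ^ 2 * m k ≤ c) (k : ℕ) :
    ∑ i ∈ Finset.range k, m i ≤ c * ((L : ℝ) ^ 2 / ((L : ℝ) ^ 2 - 1)) := by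
  have hL1 : (1 : ℝ) < L := by exact_mod_cast (lt_of_lt_of_le one_lt_two hL : 1 < L)
  have hc : 0 ≤ c := by have := hmc 0; simp only [pow_zero, Nat.cast_one, one_pow, one_mul] at this; exact (hm 0).trans this
  set ρ : ℝ := ((L : ℝ) ^ 2)⁻¹ with hρ
  have hρ0 : 0 ≤ ρ := by positivity
  have hρ1 : ρ < 1 := inv_lt_one_of_one_lt₀ (by nlinarith)
  have hgeo : (1 - ρ)⁻¹ = (L : ℝ) ^ 2 / ((L : ℝ) ^ 2 - 1) := by
    have hL2 : (L : ℝ) ^ 2 ≠ 0 := by positivity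
    rw [hρ, inv_eq_one_div ((L : ℝ) ^ 2), one_sub_div hL2, inv_div]
  have hpow : ∀ i : ℕ, ((((L ^ i : ℕ)) : ℝ)) = (L : ℝ) ^ i := fun i => by push_cast; ring
  have hterm : ∀ i ∈ Finset.range k, m i ≤ c * ρ ^ i := by
    intro i _
    have hn : (0 : ℝ) < (((L ^ i : ℕ)) : ℝ) ^ 2 := by rw [hpow]; positivity
    have h1 : m i ≤ c / (((L ^ i : ℕ)) : ℝ) ^ 2 := by rw [le_div_iff₀ hn, mul_comm]; exact hmc i
    refine h1.trans (le_of_eq ?_)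
    rw [hpow, hρ, div_eq_mul_inv, ← pow_mul, mul_comm i 2, pow_mul, inv_pow]
  refine (Finset.sum_le_sum hterm).trans ?_
  rw [← Finset.mul_sum, ← hgeo]
  have hg : ∑ i ∈ Finset.range k, ρ ^ i ≤ (1 - ρ)⁻¹ := by
    have h2 : 0 < 1 - ρ := by linarith
    rw [inv_eq_one_div, le_div_iff₀ h2, geom_sum_mul_neg]
    have : 0 ≤ ρ ^ k := pow_nonneg hρ0 k
    linarith
  exact mul_le_mul_of_nonneg_left hg hc

/-- **… K-UNIFORMLY UNDER THE SUMMABLE CLASS**: with `(L^k)²·m_k ≤ c` (the adaptedness defects are plaquette-sized in physical units) and `2 ≤ L`,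
`‖T k y j t μ − frameT (L^k) M (U k) Rc y j t μ‖ ≤ γ₀ + c·L²∕(L²−1)` for EVERY `k` — the k-uniform `γ` of the V-UB ∕ V-ONE ∕ V-P suppliers for the
COMP tower's carriers (small iff the class constant `c` is small: a small-field condition, no gauge condition). [folklore] -/
theorem tower_near_frameT_of_class (hL : 2 ≤ L) (hRc : ∀ y μ, ‖Rc y μ‖ ≤ 1) (hU' : ∀ k x, ‖U' k x‖ ≤ 1) (hR : ∀ k x μ, ‖R k x μ‖ ≤ 1)
    (hTcomp : ∀ k, T (k + 1) = compL (L ^ k) L M (T k) (frameT L (fine (L ^ k) M) (U' k) (R k)))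
    (hUcomp : ∀ k, U (k + 1) = compTv (L ^ k) L M (U k) (U' k))
    {m : ℕ → ℝ} (hm : ∀ k, 0 ≤ m k) {c : ℝ} (hmc : ∀ k, (((L ^ k : ℕ)) : ℝ) ^ 2 * m k ≤ c)
    (hin : ∀ k (y : Tor M) (j : Fin d → Fin (L ^ k)) (μ : Fin d), (j μ : ℕ) + 1 < L ^ k →
      ‖U k (bpt (L ^ k) M y j) * R k (bpt (L ^ k) M y j) μ - U k (bpt (L ^ k) M y j + unitVec (fine (L ^ k) M) μ)‖ ≤ m k)
    (hcross : ∀ k (y : Tor M) (j : Fin d → Fin (L ^ k)) (μ : Fin d), (j μ : ℕ) + 1 = L ^ k →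
      ‖U k (bpt (L ^ k) M y j) * R k (bpt (L ^ k) M y j) μ - Rc y μ * U k (bpt (L ^ k) M y j + unitVec (fine (L ^ k) M) μ)‖ ≤ m k)
    {γ₀ : ℝ} (h0 : ∀ y j t μ, ‖T 0 y j t μ - frameT (L ^ 0) M (U 0) Rc y j t μ‖ ≤ γ₀)
    (k : ℕ) (y : Tor M) (j : Fin d → Fin (L ^ k)) (t : Fin (L ^ k)) (μ : Fin d) :
    ‖T k y j t μ - frameT (L ^ k) M (U k) Rc y j t μ‖ ≤ γ₀ + c * ((L : ℝ) ^ 2 / ((L : ℝ) ^ 2 - 1)) :=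
  (tower_near_frameT L M U U' R Rc T hRc hU' hR hTcomp hUcomp hm hin hcross h0 k y j t μ).trans
    (by linarith [sum_defects_le_of_class L hL hm hmc k])
end Tower

end Summit.QuantumFields.BalabanUV.T4Continuum.VariationalVectorFrameTower

end
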